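import Literature.AlgebraicGeometry.Motives.OrthogonalRotationTensorInvariance
import Literature.AlgebraicGeometry.Motives.IsotropicPairRotationGeneration
import Mathlib.LinearAlgebra.Projection
import HarnessLib

/-!
# An isometry preserving a paired orthogonal decomposition fixes the tensors killed by the antisymmetric summand-preserving endomorphisms

The integration step ("from the Lie algebra to the group") of the tree's elementary proof of
Zarhin's theorem on the Hodge group of a Hodge structure of K3 type (Huybrechts, *Lectures on K3
Surfaces*, Thm. 3.3.9; Zarhin 1983, Thm. 2.2.1 / 2.3.1), as PURE LINEAR ALGEBRA over an
algebraically closed field `K` of characteristic `0` (applied with `K = ℂ`, `W = V_ℂ = ⊕_σ V_σ` the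
eigenspace decomposition of the endomorphism field `E`, `bar` the twist of the embeddings by the
Rosati/adjoint involution, `B = ψ_ℂ`, `g = g_ℂ` for `g ∈ SO_E(V, ψ)(ℚ)` resp. `U_E(V, ψ)(ℚ)`, and
`s = ι t` a complexified Hodge tensor, killed by the complexified Lie algebra):

Let `B` be a nondegenerate symmetric bilinear form on a finite-dimensional `W`, `W = ⊕ᵢ A i` an
internal direct sum (`iSupIndep A`, `⨆ A i = ⊤`), `bar` an involution of the index set with
`B(A i, A j) = 0` unless `j = bar i`. Let `g ∈ GL(W)` be a `B`-isometry preserving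
every `A i`, with `det (g|_{A i}) = 1` whenever `bar i = i`. **Theorem**
(`tensorSpaceActOver_eq_self_of_paired_decomposition`): every tensor `s ∈ T^{a,b} W` killed by
`ρ(Z)` for all `B`-antisymmetric `Z ∈ End W` preserving every `A i` is fixed by `g`.

Proof: `g` is the product over the `bar`-orbits of the **block maps**
`blockMap g F = 1 + (g - 1) ∑_{j ∈ F} π_j` (`g` on `⊕_{j ∈ F} A j`, the identity elsewhere;
`π_j = blockProj` the projections of the decomposition), which for `bar`-closed `F` are isometries
fixing `(⊕_F A j)^⊥`. A self-paired summand `A i` is nondegenerate and the block map is special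
orthogonal on it, hence a product of hyperbolic rotations with pairs in `A i`
(`exists_eq_prod_rotations`, Cartan–Dieudonné; `dim A i ≤ 1` is trivial); a pair `A i, A (bar i)`
consists of isotropic summands in perfect duality and the block map is a product of hyperbolic
rotations across the pair (`exists_eq_prod_rotations_of_isotropic_pair`, dilations generate `GL`).
In both cases the infinitesimal generators of the rotations are antisymmetric and preserve every
summand, so they kill `s`, and a rotation fixes what its generator kills
(`tensorSpaceActOver_rotationEquiv_eq_self`). No named facts; definitions: `blockProj`,
`blockMap`.

## References

* D. Huybrechts, *Lectures on K3 Surfaces*, CUP (2016), Thm. 3.3.9 ("The other inclusion is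
  deduced from a comparison of dimensions" — here replaced by the explicit passage from the Lie
  algebra `so_E(T)` / `u_E(T)` to the groups of rational points).
* Yu. G. Zarhin, Hodge groups of K3 surfaces, J. reine angew. Math. 341 (1983), Thm. 2.2.1, 2.3.1.
* E. Artin, *Geometric Algebra*, Interscience (1957), Ch. III–IV.
-/

noncomputable section

namespace Literature.AlgebraicGeometry.Motives

namespace OrthogonalGeneration

universe u v

section Decomposed

variable {K : Type u} [Field K] {W : Type v} [AddCommGroup W] [Module K W]
variable {ι : Type*}

/-! ### Block projections of an internal direct sum -/

/-- The summand `A i` and the sum of the other summands are complementary. [folklore] -/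
theorem isCompl_iSup_ne {A : ι → Submodule K W} (hind : iSupIndep A) (htop : ⨆ i, A i = ⊤)
    (i : ι) : IsCompl (A i) (⨆ (j : ι) (_ : j ≠ i), A j) :=
  ⟨hind i, codisjoint_iff.2 (by rw [← iSup_split_single A i, htop])⟩

/-- The **block projection** onto the summand `A i` along the others. [folklore] -/
def blockProj (A : ι → Submodule K W) (hind : iSupIndep A) (htop : ⨆ i, A i = ⊤) (i : ι) :
    Module.End K W :=
  (A i).projection (⨆ (j : ι) (_ : j ≠ i), A j) (isCompl_iSup_ne hind htop i)

variable {A : ι → Submodule K W} (hind : iSupIndep A) (htop : ⨆ i, A i = ⊤)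

/-- The block projection is the identity on its summand. [folklore] -/
theorem blockProj_apply_of_mem {i : ι} {x : W} (hx : x ∈ A i) : blockProj A hind htop i x = x :=
  Submodule.projection_apply_of_mem_left _ hx

/-- The block projection kills the other summands. [folklore] -/
theorem blockProj_apply_of_mem_ne {i k : ι} (hk : k ≠ i) {x : W} (hx : x ∈ A k) :
    blockProj A hind htop i x = 0 :=
  Submodule.projection_apply_of_mem_right _
    (Submodule.mem_iSup_of_mem k (Submodule.mem_iSup_of_mem hk hx))

/-- The block projection takes values in its summand. [folklore] -/
theorem blockProj_mem (i : ι) (x : W) : blockProj A hind htop i x ∈ A i :=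
  Submodule.projection_apply_mem _ x

include htop in
/-- **Extension from the summands**: two linear maps agreeing on every summand are equal.
[folklore] -/
theorem linearMap_ext_of_forall_mem {N : Type*} [AddCommGroup N] [Module K N] {f f' : W →ₗ[K] N}
    (h : ∀ i, ∀ x ∈ A i, f x = f' x) : f = f' := by
  refine LinearMap.ext fun x => ?_
  have hx : x ∈ ⨆ i, A i := by rw [htop]; exact Submodule.mem_top
  induction hx using Submodule.iSup_induction' with
  | mem i x hx => exact h i x hx
  | zero => simp
  | add x y _ _ hx hy => rw [map_add, map_add, hx, hy]

/-- The block projections sum to the identity. [folklore] -/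
theorem sum_blockProj [Fintype ι] : ∑ i, blockProj A hind htop i = 1 := by
  refine linearMap_ext_of_forall_mem htop fun k x hx => ?_
  rw [LinearMap.sum_apply, Module.End.one_apply, Finset.sum_eq_single k
    (fun i _ hik => blockProj_apply_of_mem_ne hind htop (Ne.symm hik) hx)
    (fun h => absurd (Finset.mem_univ k) h), blockProj_apply_of_mem hind htop hx]

/-- Every vector is the sum of its block components. [folklore] -/
theorem sum_blockProj_apply [Fintype ι] (x : W) : ∑ i, blockProj A hind htop i x = x := by
  have h := congrArg (fun f : Module.End K W => f x) (sum_blockProj hind htop)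
  simpa using h

/-! ### Block maps: `g` on a union of summands, the identity elsewhere -/

/-- The **block map** `1 + (g - 1) ∑_{j ∈ F} π_j`: it is `g` on the summands `A j`, `j ∈ F`, and
the identity on the other summands (when `g` preserves the summands). [folklore] -/
def blockMap (A : ι → Submodule K W) (hind : iSupIndep A) (htop : ⨆ i, A i = ⊤)
    (g : Module.End K W) (F : Finset ι) : Module.End K W :=
  1 + (g - 1) * ∑ j ∈ F, blockProj A hind htop j

/-- The block map on a summand inside `F` is `g`. [folklore] -/
theorem blockMap_apply_of_mem_of_mem (g : Module.End K W) {F : Finset ι} {k : ι} (hk : k ∈ F)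
    {x : W} (hx : x ∈ A k) : blockMap A hind htop g F x = g x := by
  rw [blockMap, LinearMap.add_apply, Module.End.one_apply, Module.End.mul_apply,
    LinearMap.sum_apply, Finset.sum_eq_single k
      (fun j _ hjk => blockProj_apply_of_mem_ne hind htop (Ne.symm hjk) hx)
      (fun h => absurd hk h), blockProj_apply_of_mem hind htop hx, LinearMap.sub_apply,
    Module.End.one_apply, add_sub_cancel]

/-- The block map on a summand outside `F` is the identity. [folklore] -/
theorem blockMap_apply_of_mem_of_not_mem (g : Module.End K W) {F : Finset ι} {k : ι} (hk : k ∉ F)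
    {x : W} (hx : x ∈ A k) : blockMap A hind htop g F x = x := by
  rw [blockMap, LinearMap.add_apply, Module.End.one_apply, Module.End.mul_apply,
    LinearMap.sum_apply, Finset.sum_eq_zero (fun j hj => ?_), map_zero, add_zero]
  exact blockProj_apply_of_mem_ne hind htop (fun h : k = j => hk (h ▸ hj)) hx

/-- The block map of the empty set is the identity. [folklore] -/
theorem blockMap_empty (g : Module.End K W) : blockMap A hind htop g ∅ = 1 := by
  rw [blockMap, Finset.sum_empty, mul_zero, add_zero]

/-- The block map of all indices is `g`. [folklore] -/
theorem blockMap_univ [Fintype ι] (g : Module.End K W) : blockMap A hind htop g Finset.univ = g := by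
  rw [blockMap, sum_blockProj hind htop, mul_one, add_sub_cancel]

/-- **Block maps of disjoint index sets multiply** (when `g` preserves the summands):
`blockMap (F ∪ G) = blockMap F * blockMap G` for disjoint `F, G`. [folklore] -/
theorem blockMap_union [DecidableEq ι] (g : Module.End K W) (hgA : ∀ i, ∀ x ∈ A i, g x ∈ A i)
    {F G : Finset ι}
    (hFG : Disjoint F G) :
    blockMap A hind htop g (F ∪ G) = blockMap A hind htop g F * blockMap A hind htop g G := by
  refine linearMap_ext_of_forall_mem htop fun k x hx => ?_
  rw [Module.End.mul_apply]
  by_cases hkG : k ∈ G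
  · have hkF : k ∉ F := fun h => Finset.disjoint_left.1 hFG h hkG
    rw [blockMap_apply_of_mem_of_mem hind htop g (Finset.mem_union_right F hkG) hx,
      blockMap_apply_of_mem_of_mem hind htop g hkG hx,
      blockMap_apply_of_mem_of_not_mem hind htop g hkF (hgA k x hx)]
  · rw [blockMap_apply_of_mem_of_not_mem hind htop g hkG hx]
    by_cases hkF : k ∈ F
    · rw [blockMap_apply_of_mem_of_mem hind htop g (Finset.mem_union_left G hkF) hx,
        blockMap_apply_of_mem_of_mem hind htop g hkF hx]
    · rw [blockMap_apply_of_mem_of_not_mem hind htop g (by simp [hkF, hkG]) hx,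
        blockMap_apply_of_mem_of_not_mem hind htop g hkF hx]

/-! ### Orthogonality structure: summands paired by an involution -/

section Paired

variable {B : LinearMap.BilinForm K W} {bar : ι → ι}

/-- **Block maps on `bar`-closed index sets are isometries** (when `g` is an isometry preserving
the summands and `B(A i, A j) = 0` for `j ≠ bar i`). [folklore] -/
theorem isOrthogonal_blockMap [Fintype ι] (horth : ∀ i j, j ≠ bar i → ∀ x ∈ A i, ∀ y ∈ A j, B x y = 0)
    (hbar : Function.Involutive bar) {g : Module.End K W} (hg : B.IsOrthogonal g)
    (hgA : ∀ i, ∀ x ∈ A i, g x ∈ A i) {F : Finset ι} (hbarF : ∀ j ∈ F, bar j ∈ F) :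
    B.IsOrthogonal (blockMap A hind htop g F) := by
  -- homogeneous case
  have hom : ∀ k, ∀ x ∈ A k, ∀ l, ∀ y ∈ A l,
      B (blockMap A hind htop g F x) (blockMap A hind htop g F y) = B x y := by
    intro k x hx l y hy
    by_cases hk : k ∈ F <;> by_cases hl : l ∈ F
    · rw [blockMap_apply_of_mem_of_mem hind htop g hk hx, blockMap_apply_of_mem_of_mem hind htop g hl hy,
        hg]
    · rw [blockMap_apply_of_mem_of_mem hind htop g hk hx,
        blockMap_apply_of_mem_of_not_mem hind htop g hl hy]
      have hlk : l ≠ bar k := fun h => hl (h ▸ hbarF k hk)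
      rw [horth k l hlk _ (hgA k x hx) _ hy, horth k l hlk _ hx _ hy]
    · rw [blockMap_apply_of_mem_of_not_mem hind htop g hk hx,
        blockMap_apply_of_mem_of_mem hind htop g hl hy]
      have hlk : l ≠ bar k := by
        intro h
        apply hk
        have := hbarF l hl
        rwa [h, hbar k] at this
      rw [horth k l hlk _ hx _ (hgA l y hy), horth k l hlk _ hx _ hy]
    · rw [blockMap_apply_of_mem_of_not_mem hind htop g hk hx,
        blockMap_apply_of_mem_of_not_mem hind htop g hl hy]
  intro x y
  conv_lhs => rw [← sum_blockProj_apply hind htop x, ← sum_blockProj_apply hind htop y]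
  conv_rhs => rw [← sum_blockProj_apply hind htop x, ← sum_blockProj_apply hind htop y]
  simp only [map_sum, LinearMap.sum_apply]
  refine Finset.sum_congr rfl fun k _ => Finset.sum_congr rfl fun l _ => ?_
  exact hom l _ (blockProj_mem hind htop l x) k _ (blockProj_mem hind htop k y)

/-- **Components of a vector orthogonal to the summands indexed by a `bar`-closed `F` vanish on
`F`.** [folklore] -/
theorem blockProj_eq_zero_of_mem_orthogonal [Fintype ι] (hB : B.IsSymm) (hBn : B.Nondegenerate)
    (horth : ∀ i j, j ≠ bar i → ∀ x ∈ A i, ∀ y ∈ A j, B x y = 0) (hbar : Function.Involutive bar) {F : Finset ι}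
    (hbarF : ∀ j ∈ F, bar j ∈ F) {w : W} (hw : w ∈ B.orthogonal (⨆ j ∈ F, A j)) {j : ι}
    (hj : j ∈ F) : blockProj A hind htop j w = 0 := by
  rw [LinearMap.BilinForm.mem_orthogonal_iff] at hw
  refine hBn.1 _ fun z => ?_
  conv_lhs => rw [← sum_blockProj_apply hind htop z]
  rw [map_sum]
  refine Finset.sum_eq_zero fun l _ => ?_
  by_cases hl : l = bar j
  · subst hl
    -- `B (w_j, z_{bar j}) = B (w, z_{bar j}) - Σ_{k ≠ j} B (w_k, z_{bar j}) = 0`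
    have hz : blockProj A hind htop (bar j) z ∈ ⨆ j ∈ F, A j :=
      Submodule.mem_iSup_of_mem (bar j) (Submodule.mem_iSup_of_mem (hbarF j hj)
        (blockProj_mem hind htop _ z))
    have h1 : B w (blockProj A hind htop (bar j) z) = 0 := by rw [hB.eq]; exact hw _ hz
    have h2 : B w (blockProj A hind htop (bar j) z) =
        ∑ k, B (blockProj A hind htop k w) (blockProj A hind htop (bar j) z) := by
      conv_lhs => rw [← sum_blockProj_apply hind htop w]
      rw [map_sum, LinearMap.sum_apply]
    rw [h2, Finset.sum_eq_single j (fun k _ hkj => horth k (bar j)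
      (fun h => hkj (hbar.injective h).symm) _ (blockProj_mem hind htop k w) _
      (blockProj_mem hind htop _ z)) (fun h => absurd (Finset.mem_univ j) h)] at h1
    exact h1
  · exact horth j l hl _ (blockProj_mem hind htop j w) _ (blockProj_mem hind htop l z)

/-- **Block maps fix the orthogonal of their support** (`bar`-closed `F`). [folklore] -/
theorem blockMap_apply_of_mem_orthogonal [Fintype ι] (hB : B.IsSymm) (hBn : B.Nondegenerate)
    (horth : ∀ i j, j ≠ bar i → ∀ x ∈ A i, ∀ y ∈ A j, B x y = 0) (hbar : Function.Involutive bar) (g : Module.End K W)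
    {F : Finset ι} (hbarF : ∀ j ∈ F, bar j ∈ F) {w : W} (hw : w ∈ B.orthogonal (⨆ j ∈ F, A j)) :
    blockMap A hind htop g F w = w := by
  conv_lhs => rw [← sum_blockProj_apply hind htop w]
  conv_rhs => rw [← sum_blockProj_apply hind htop w]
  rw [map_sum]
  refine Finset.sum_congr rfl fun k _ => ?_
  by_cases hk : k ∈ F
  · rw [blockProj_eq_zero_of_mem_orthogonal hind htop hB hBn horth hbar hbarF hw hk, map_zero]
  · exact blockMap_apply_of_mem_of_not_mem hind htop g hk (blockProj_mem hind htop k w)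

include hind htop in
/-- **A self-paired summand is nondegenerate.** [folklore] -/
theorem restrict_nondegenerate_of_bar_eq [Fintype ι] (hB : B.IsSymm) (hBn : B.Nondegenerate)
    (horth : ∀ i j, j ≠ bar i → ∀ x ∈ A i, ∀ y ∈ A j, B x y = 0) {i : ι} (hi : bar i = i) :
    (B.restrict (A i)).Nondegenerate := by
  have key : ∀ u ∈ A i, (∀ v ∈ A i, B u v = 0) → u = 0 := by
    intro u hu h
    refine hBn.1 u fun z => ?_
    conv_lhs => rw [← sum_blockProj_apply hind htop z]
    rw [map_sum]
    refine Finset.sum_eq_zero fun l _ => ?_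
    by_cases hl : l = i
    · subst hl
      exact h _ (blockProj_mem hind htop l z)
    · exact horth i l (by rw [hi]; exact hl) _ hu _ (blockProj_mem hind htop l z)
  refine ⟨fun u hu => Subtype.ext (key u u.2 fun v hv => hu ⟨v, hv⟩),
    fun u hu => Subtype.ext (key u u.2 fun v hv => ?_)⟩
  rw [hB.eq]
  exact hu ⟨v, hv⟩

/-- **The determinant of the block map on one summand is that of the restriction.** [folklore] -/
theorem det_blockMap_singleton [FiniteDimensional K W] (g : Module.End K W)
    (hgA : ∀ i, ∀ x ∈ A i, g x ∈ A i) (i : ι) :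
    LinearMap.det (blockMap A hind htop g {i}) = LinearMap.det (g.restrict (hgA i)) := by
  set p : Submodule K W := A i with hp
  set q : Submodule K W := ⨆ (j : ι) (_ : j ≠ i), A j with hq
  have hc : IsCompl p q := isCompl_iSup_ne hind htop i
  set e := Submodule.prodEquivOfIsCompl p q hc with he
  have key : blockMap A hind htop g {i} =
      (e : (p × q) →ₗ[K] W) ∘ₗ ((g.restrict (hgA i)).prodMap (LinearMap.id : q →ₗ[K] q)) ∘ₗ
        (e.symm : W →ₗ[K] (p × q)) := by
    refine LinearMap.ext fun x => ?_
    obtain ⟨y, rfl⟩ := e.surjective x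
    simp only [LinearMap.coe_comp, LinearEquiv.coe_coe, Function.comp_apply,
      LinearEquiv.symm_apply_apply, LinearMap.prodMap_apply, LinearMap.id_apply]
    rw [he, Submodule.coe_prodEquivOfIsCompl', Submodule.coe_prodEquivOfIsCompl', map_add]
    congr 1
    · rw [LinearMap.coe_restrict_apply]
      exact blockMap_apply_of_mem_of_mem hind htop g (Finset.mem_singleton_self i) y.1.2
    · have hfixq : ∀ z ∈ (⨆ (j : ι) (_ : j ≠ i), A j), blockMap A hind htop g {i} z = z := by
        intro z hz
        induction hz using Submodule.iSup_induction' with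
        | mem j z hz =>
          by_cases hji : j ≠ i
          · rw [iSup_pos hji] at hz
            exact blockMap_apply_of_mem_of_not_mem hind htop g (by simpa using hji) hz
          · rw [iSup_neg hji, Submodule.mem_bot] at hz
            rw [hz, map_zero]
        | zero => simp
        | add z z' _ _ hz hz' => rw [map_add, hz, hz']
      exact hfixq _ y.2.2
  rw [key, LinearMap.det_conj ((g.restrict (hgA i)).prodMap (LinearMap.id : q →ₗ[K] q)) e,
    LinearMap.det_prodMap, LinearMap.det_id, mul_one]

/-- In a space of dimension `≤ 1`, an endomorphism of determinant `1` is the identity.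
[folklore] -/
theorem eq_one_of_det_eq_one_of_finrank_le_one {U : Type*} [AddCommGroup U] [Module K U]
    [FiniteDimensional K U] (f : Module.End K U) (hU : Module.finrank K U ≤ 1)
    (hf : LinearMap.det f = 1) : f = 1 := by
  rcases Nat.le_one_iff_eq_zero_or_eq_one.1 hU with h0 | h1
  · haveI : Subsingleton U := Module.finrank_zero_iff.1 h0
    exact LinearMap.ext fun x => Subsingleton.elim _ _
  · obtain ⟨b⟩ := (Module.finBasisOfFinrankEq K U h1 : _ ) |> fun b => (⟨b⟩ : Nonempty _)
    set c := b.repr (f (b 0)) 0 with hc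
    have hfb : f (b 0) = c • b 0 := by
      have h := b.sum_repr (f (b 0))
      rw [Fin.sum_univ_one] at h
      exact h.symm
    have hf' : f = c • 1 := by
      refine b.ext fun k => ?_
      fin_cases k
      simp [hfb]
    have hdet : LinearMap.det f = c := by
      rw [hf', LinearMap.det_smul, map_one, mul_one, h1, pow_one]
    have hc1 : c = 1 := by rw [← hdet, hf]
    rw [hf', hc1, one_smul]

end Paired

/-! ### Words in rotations whose generators kill a tensor fix it -/

open scoped TensorProduct

/-- If `⇑k` is a word in hyperbolic rotations each of whose generators kills the tensor `s`
(through the derivation action), then `k` fixes `s` (characteristic `0`). [folklore] -/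
theorem tensorSpaceActOver_eq_self_of_coe_eq_prod_rotations [CharZero K] [FiniteDimensional K W]
    {B : LinearMap.BilinForm K W} (hB : B.IsSymm) {a b : ℕ} {s : hodgeTensorSpaceOver K W a b} :
    ∀ (R : List (W × W × K)),
      (∀ r ∈ R, B r.1 r.1 = 0 ∧ B r.2.1 r.2.1 = 0 ∧ B r.1 r.2.1 = 1 ∧ r.2.2 ≠ 0 ∧
        tensorDerivation a b (rotationGenerator B r.1 r.2.1) s = 0) →
      ∀ k : W ≃ₗ[K] W, (⇑k : W → W) = ⇑(R.map fun r => rotation B r.1 r.2.1 r.2.2).prod →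
        tensorSpaceActOver k s = s := by
  intro R
  induction R with
  | nil =>
    intro _ k hk
    have hk1 : k = 1 := by
      refine LinearEquiv.ext fun x => ?_
      have := congrFun hk x
      simpa using this
    rw [hk1, tensorSpaceActOver_one]
    rfl
  | cons r R ih =>
    intro hR k hk
    obtain ⟨h1, h2, h3, h4, h5⟩ := hR r List.mem_cons_self
    set kr := rotationEquiv hB h1 h2 h3 h4 with hkr
    set k' := kr⁻¹ * k with hk'
    have hk'coe : (⇑k' : W → W) = ⇑(R.map fun r => rotation B r.1 r.2.1 r.2.2).prod := by
      funext x
      have hx := congrFun hk x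
      simp only [List.map_cons, List.prod_cons, Module.End.mul_apply] at hx
      rw [hk', LinearEquiv.mul_eq_trans, LinearEquiv.trans_apply, hx]
      change kr.symm (rotation B r.1 r.2.1 r.2.2 _) = _
      rw [← coe_rotationEquiv hB h1 h2 h3 h4, ← hkr]
      exact LinearEquiv.symm_apply_apply kr _
    have hfix' := ih (fun r' hr' => hR r' (List.mem_cons_of_mem r hr')) k' hk'coe
    have hkk : k = kr * k' := by rw [hk', ← mul_assoc, mul_inv_cancel, one_mul]
    rw [hkk, tensorSpaceActOver_mul]
    change tensorSpaceActOver kr (tensorSpaceActOver k' s) = s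
    rw [hfix', hkr, tensorSpaceActOver_rotationEquiv_eq_self hB h1 h2 h3 h4 h5]

/-! ### The two cases: a self-paired summand, and a pair of summands in duality -/

section Cases

variable {B : LinearMap.BilinForm K W} {bar : ι → ι}

/-- An isometry of a nondegenerate form is injective. [folklore] -/
theorem injective_of_isOrthogonal (hBn : B.Nondegenerate) {f : Module.End K W}
    (hf : B.IsOrthogonal f) : Function.Injective f := by
  intro x y hxy
  rw [← sub_eq_zero] at hxy ⊢
  refine hBn.1 _ fun z => ?_
  rw [← hf, map_sub, hxy, map_zero, LinearMap.zero_apply]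

/-- **Case A (self-paired summand).** If `bar i = i`, `det (g|_{A i}) = 1`, and every
`B`-antisymmetric `Z` preserving all summands kills `s`, then the block map of `g` on `A i` fixes
`s`: it is a special orthogonal transformation supported on the nondegenerate `A i`, hence a
product of hyperbolic rotations with pairs in `A i` (`exists_eq_prod_rotations`), whose generators
preserve every summand. [folklore] -/
theorem tensorSpaceActOver_blockMap_singleton_eq_self [IsAlgClosed K] [CharZero K]
    [FiniteDimensional K W] [Fintype ι] [DecidableEq ι] (hB : B.IsSymm) (hBn : B.Nondegenerate)
    (horth : ∀ i j, j ≠ bar i → ∀ x ∈ A i, ∀ y ∈ A j, B x y = 0) (hbar : Function.Involutive bar) (g : Module.End K W)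
    (hg : B.IsOrthogonal g) (hgA : ∀ i, ∀ x ∈ A i, g x ∈ A i) {i : ι} (hi : bar i = i)
    (hdet : LinearMap.det (g.restrict (hgA i)) = 1) {a b : ℕ} {s : hodgeTensorSpaceOver K W a b}
    (hs : ∀ Z : Module.End K W, (∀ j, ∀ x ∈ A j, Z x ∈ A j) →
      (∀ x y, B (Z x) y + B x (Z y) = 0) → tensorDerivation a b Z s = 0)
    (k : W ≃ₗ[K] W) (hk : (⇑k : W → W) = ⇑(blockMap A hind htop g {i})) :
    tensorSpaceActOver k s = s := by
  haveI : NeZero (2 : K) := ⟨two_ne_zero⟩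
  have hbarF : ∀ j ∈ ({i} : Finset ι), bar j ∈ ({i} : Finset ι) := by
    intro j hj
    rw [Finset.mem_singleton] at hj ⊢
    rw [hj, hi]
  have hiso : B.IsOrthogonal (blockMap A hind htop g {i}) :=
    isOrthogonal_blockMap hind htop horth hbar hg hgA hbarF
  have hUnd : (B.restrict (A i)).Nondegenerate := restrict_nondegenerate_of_bar_eq hind htop hB hBn horth hi
  have hfix : ∀ w ∈ B.orthogonal (A i), blockMap A hind htop g {i} w = w := by
    intro w hw
    refine blockMap_apply_of_mem_orthogonal hind htop hB hBn horth hbar g hbarF ?_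
    rwa [Finset.iSup_singleton]
  have hdet1 : LinearMap.det (blockMap A hind htop g {i}) = 1 := by
    rw [det_blockMap_singleton hind htop g hgA i, hdet]
  by_cases h2U : 2 ≤ Module.finrank K (A i)
  · obtain ⟨R, hR, hprod⟩ :=
      exists_eq_prod_rotations hB hBn (A i) hUnd h2U _ hiso hfix hdet1
    refine tensorSpaceActOver_eq_self_of_coe_eq_prod_rotations hB R (fun r hr => ?_) k
      (by rw [hk, hprod])
    obtain ⟨he, hf, hee, hff, hef, hz⟩ := hR r hr
    refine ⟨hee, hff, hef, hz, hs _ (fun j x hx => ?_) (form_rotationGenerator_add hB)⟩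
    rw [rotationGenerator_apply]
    by_cases hji : j = i
    · subst hji
      exact (A j).sub_mem ((A j).smul_mem _ he) ((A j).smul_mem _ hf)
    · have hji' : j ≠ bar i := by rwa [hi]
      rw [horth i j hji' _ hf _ hx, horth i j hji' _ he _ hx, zero_smul, zero_smul, sub_zero]
      exact (A j).zero_mem
  · -- `dim A i ≤ 1`: `g|_{A i} = 1`, so the block map is the identity
    have hle : Module.finrank K (A i) ≤ 1 := by omega
    have hres : g.restrict (hgA i) = 1 := eq_one_of_det_eq_one_of_finrank_le_one _ hle hdet
    have hone : blockMap A hind htop g {i} = 1 := by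
      refine linearMap_ext_of_forall_mem htop fun j x hx => ?_
      by_cases hji : j = i
      · subst hji
        rw [blockMap_apply_of_mem_of_mem hind htop g (Finset.mem_singleton_self j) hx,
          Module.End.one_apply]
        have h := congrArg Subtype.val (LinearMap.congr_fun hres ⟨x, hx⟩)
        rwa [LinearMap.coe_restrict_apply] at h
      · exact blockMap_apply_of_mem_of_not_mem hind htop g (by simpa using hji) hx
    have hk1 : k = 1 := by
      refine LinearEquiv.ext fun x => ?_
      have := congrFun hk x
      rw [hone] at this
      simpa using this
    rw [hk1, tensorSpaceActOver_one]
    rfl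

/-- **Case B (a pair of summands in duality).** If `bar i ≠ i` and every `B`-antisymmetric `Z`
preserving all summands kills `s`, then the block map of `g` on `A i ⊕ A (bar i)` fixes `s`: it
is an isometry preserving the two isotropic summands in perfect duality, hence a product of
hyperbolic rotations across the pair (`exists_eq_prod_rotations_of_isotropic_pair`), whose
generators preserve every summand. [folklore] -/
theorem tensorSpaceActOver_blockMap_pair_eq_self [CharZero K] [FiniteDimensional K W] [Fintype ι]
    [DecidableEq ι] (hB : B.IsSymm) (hBn : B.Nondegenerate) (horth : ∀ i j, j ≠ bar i → ∀ x ∈ A i, ∀ y ∈ A j, B x y = 0)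
    (hbar : Function.Involutive bar) (g : Module.End K W) (hg : B.IsOrthogonal g)
    (hgA : ∀ i, ∀ x ∈ A i, g x ∈ A i) {i : ι} (hi : bar i ≠ i) {a b : ℕ}
    {s : hodgeTensorSpaceOver K W a b}
    (hs : ∀ Z : Module.End K W, (∀ j, ∀ x ∈ A j, Z x ∈ A j) →
      (∀ x y, B (Z x) y + B x (Z y) = 0) → tensorDerivation a b Z s = 0)
    (k : W ≃ₗ[K] W) (hk : (⇑k : W → W) = ⇑(blockMap A hind htop g {i, bar i})) :
    tensorSpaceActOver k s = s := by
  haveI : NeZero (2 : K) := ⟨two_ne_zero⟩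
  have hbarF : ∀ j ∈ ({i, bar i} : Finset ι), bar j ∈ ({i, bar i} : Finset ι) := by
    intro j hj
    simp only [Finset.mem_insert, Finset.mem_singleton] at hj ⊢
    rcases hj with rfl | rfl
    · exact Or.inr rfl
    · exact Or.inl (hbar i)
  have hiso : B.IsOrthogonal (blockMap A hind htop g {i, bar i}) :=
    isOrthogonal_blockMap hind htop horth hbar hg hgA hbarF
  have hUU : ∀ x ∈ A i, ∀ y ∈ A i, B x y = 0 := horth i i (Ne.symm hi)
  have hU'U' : ∀ x ∈ A (bar i), ∀ y ∈ A (bar i), B x y = 0 :=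
    horth (bar i) (bar i) (by rw [hbar i]; exact hi)
  -- perfect duality `A (bar i) → (A i)^∨`
  have hdual : ∀ φ : Module.Dual K (A i), ∃ f ∈ A (bar i), ∀ u : A i, B f u = φ u := by
    intro φ
    set Φ : Module.Dual K W :=
      φ ∘ₗ (A i).projectionOnto (⨆ (j : ι) (_ : j ≠ i), A j) (isCompl_iSup_ne hind htop i) with hΦ
    set f₀ := (B.toDual hBn).symm Φ with hf₀
    refine ⟨blockProj A hind htop (bar i) f₀, blockProj_mem hind htop _ f₀, fun u => ?_⟩
    have h1 : B f₀ u = φ u := by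
      rw [hf₀, LinearMap.BilinForm.apply_toDual_symm_apply, hΦ, LinearMap.comp_apply,
        Submodule.projectionOnto_apply_left]
    rw [← h1]
    conv_rhs => rw [← sum_blockProj_apply hind htop f₀]
    rw [map_sum, LinearMap.sum_apply, Finset.sum_eq_single (bar i) (fun l _ hl =>
      horth l i (fun h => hl (by rw [h, hbar l])) _ (blockProj_mem hind htop l f₀) _ u.2)
      (fun h => absurd (Finset.mem_univ _) h)]
  have hsep : ∀ x ∈ A (bar i), (∀ u ∈ A i, B x u = 0) → x = 0 := by
    intro x hx h
    refine hBn.1 x fun z => ?_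
    conv_lhs => rw [← sum_blockProj_apply hind htop z]
    rw [map_sum]
    refine Finset.sum_eq_zero fun l _ => ?_
    by_cases hl : l = i
    · subst hl
      exact h _ (blockProj_mem hind htop l z)
    · exact horth (bar i) l (by rw [hbar i]; exact hl) _ hx _ (blockProj_mem hind htop l z)
  have hpresU : ∀ u ∈ A i, blockMap A hind htop g {i, bar i} u ∈ A i := fun u hu => by
    rw [blockMap_apply_of_mem_of_mem hind htop g (by simp) hu]
    exact hgA i u hu
  have hpresU' : ∀ x ∈ A (bar i), blockMap A hind htop g {i, bar i} x ∈ A (bar i) := fun x hx => by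
    rw [blockMap_apply_of_mem_of_mem hind htop g (by simp) hx]
    exact hgA _ x hx
  have hfix : ∀ w ∈ B.orthogonal (A i ⊔ A (bar i)), blockMap A hind htop g {i, bar i} w = w := by
    intro w hw
    refine blockMap_apply_of_mem_orthogonal hind htop hB hBn horth hbar g hbarF ?_
    rwa [Finset.iSup_insert, Finset.iSup_singleton]
  obtain ⟨R, hR, hprod⟩ := exists_eq_prod_rotations_of_isotropic_pair hB hBn (A i) (A (bar i)) hUU
    hU'U' hdual hsep _ hiso hpresU hpresU' hfix
  refine tensorSpaceActOver_eq_self_of_coe_eq_prod_rotations hB R (fun r hr => ?_) k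
    (by rw [hk, hprod])
  obtain ⟨he, hf, hee, hff, hef, hz⟩ := hR r hr
  refine ⟨hee, hff, hef, hz, hs _ (fun j x hx => ?_) (form_rotationGenerator_add hB)⟩
  rw [rotationGenerator_apply]
  by_cases hji : j = i
  · subst hji
    rw [hUU _ he _ hx, zero_smul, sub_zero]
    exact (A j).smul_mem _ he
  · by_cases hjb : j = bar i
    · subst hjb
      rw [hU'U' _ hf _ hx, zero_smul, zero_sub]
      exact (A (bar i)).neg_mem ((A (bar i)).smul_mem _ hf)
    · rw [horth (bar i) j (by rw [hbar i]; exact hji) _ hf _ hx, horth i j hjb _ he _ hx, zero_smul,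
        zero_smul, sub_zero]
      exact (A j).zero_mem

end Cases

/-! ### Main theorem -/

include hind htop in
/-- **An isometry preserving the summands of a paired orthogonal decomposition fixes every tensor
killed by the antisymmetric summand-preserving endomorphisms.** Let `B` be a nondegenerate
symmetric bilinear form on a finite-dimensional space `W` over an algebraically closed field of
characteristic `0`, `W = ⊕ᵢ A i` an internal direct sum and `bar` an involution of the indices
with `B(A i, A j) = 0` unless `j = bar i`. Let `g ∈ GL(W)` be a `B`-isometry preserving each `A i`,
with `det (g|_{A i}) = 1` whenever `bar i = i`. If a tensor `s ∈ T^{a,b} W` is killed by `ρ(Z)` for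
every `B`-antisymmetric `Z ∈ End(W)` preserving each `A i`, then `g · s = s`. (The group
`{g}`-to-Lie-algebra passage of Zarhin's theorem, Huybrechts, *Lectures on K3 Surfaces*,
Thm. 3.3.9: `g = ∏` over the `bar`-orbits of block maps, each a product of hyperbolic rotations —
`SO` of a nondegenerate summand, resp. the `GL`-Levi action on a pair of isotropic summands in
duality — whose infinitesimal generators are antisymmetric and preserve the summands.)
[folklore] -/
theorem tensorSpaceActOver_eq_self_of_paired_decomposition [IsAlgClosed K] [CharZero K]
    [FiniteDimensional K W] [Fintype ι] [DecidableEq ι] {B : LinearMap.BilinForm K W}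
    {bar : ι → ι} (hB : B.IsSymm) (hBn : B.Nondegenerate) (horth : ∀ i j, j ≠ bar i → ∀ x ∈ A i, ∀ y ∈ A j, B x y = 0)
    (hbar : Function.Involutive bar) (g : W ≃ₗ[K] W) (hg : B.IsOrthogonal g)
    (hgA : ∀ i, ∀ x ∈ A i, g x ∈ A i)
    (hdet : ∀ i, bar i = i → LinearMap.det ((g : W →ₗ[K] W).restrict (hgA i)) = 1) {a b : ℕ}
    {s : hodgeTensorSpaceOver K W a b}
    (hs : ∀ Z : Module.End K W, (∀ j, ∀ x ∈ A j, Z x ∈ A j) →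
      (∀ x y, B (Z x) y + B x (Z y) = 0) → tensorDerivation a b Z s = 0) :
    tensorSpaceActOver g s = s := by
  set g₀ : Module.End K W := (g : W →ₗ[K] W) with hg₀
  have hg₀orth : B.IsOrthogonal g₀ := hg
  have hgA₀ : ∀ i, ∀ x ∈ A i, g₀ x ∈ A i := hgA
  -- induction on `bar`-closed finite sets of indices
  suffices key : ∀ (n : ℕ) (F : Finset ι), F.card = n → (∀ j ∈ F, bar j ∈ F) →
      ∀ k : W ≃ₗ[K] W, (⇑k : W → W) = ⇑(blockMap A hind htop g₀ F) → tensorSpaceActOver k s = s by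
    refine key _ Finset.univ rfl (fun j _ => Finset.mem_univ _) g ?_
    rw [blockMap_univ hind htop g₀]
    rfl
  intro n
  induction n using Nat.strong_induction_on with
  | _ n ih =>
  intro F hcard hbarF k hk
  by_cases hF : F = ∅
  · subst hF
    have hk1 : k = 1 := by
      refine LinearEquiv.ext fun x => ?_
      have := congrFun hk x
      rw [blockMap_empty] at this
      simpa using this
    rw [hk1, tensorSpaceActOver_one]
    rfl
  obtain ⟨i, hiF⟩ := Finset.nonempty_iff_ne_empty.2 hF
  set G : Finset ι := {i, bar i} with hG
  have hGF : G ⊆ F := by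
    intro j hj
    simp only [hG, Finset.mem_insert, Finset.mem_singleton] at hj
    rcases hj with rfl | rfl
    exacts [hiF, hbarF _ hiF]
  set F' : Finset ι := F \ G with hF'
  have hbarG : ∀ j ∈ G, bar j ∈ G := by
    intro j hj
    simp only [hG, Finset.mem_insert, Finset.mem_singleton] at hj ⊢
    rcases hj with rfl | rfl
    · exact Or.inr rfl
    · exact Or.inl (hbar i)
  have hbarF' : ∀ j ∈ F', bar j ∈ F' := by
    intro j hj
    rw [hF', Finset.mem_sdiff] at hj ⊢
    refine ⟨hbarF j hj.1, fun h => hj.2 ?_⟩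
    have := hbarG _ h
    rwa [hbar j] at this
  have hunion : F = F' ∪ G := by rw [hF', Finset.sdiff_union_of_subset hGF]
  have hdisj : Disjoint F' G := by rw [hF']; exact Finset.sdiff_disjoint
  have hcard' : F'.card < n := by
    rw [← hcard, hF']
    exact Finset.card_lt_card (Finset.sdiff_ssubset hGF ⟨i, by simp [hG]⟩)
  -- the two factors as automorphisms
  have hisoF' : B.IsOrthogonal (blockMap A hind htop g₀ F') :=
    isOrthogonal_blockMap hind htop horth hbar hg₀orth hgA₀ hbarF'
  have hisoG : B.IsOrthogonal (blockMap A hind htop g₀ G) :=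
    isOrthogonal_blockMap hind htop horth hbar hg₀orth hgA₀ hbarG
  set kF' := LinearEquiv.ofInjectiveEndo _ (injective_of_isOrthogonal hBn hisoF') with hkF'
  set kG := LinearEquiv.ofInjectiveEndo _ (injective_of_isOrthogonal hBn hisoG) with hkG
  have hkF'coe : (⇑kF' : W → W) = ⇑(blockMap A hind htop g₀ F') := rfl
  have hkGcoe : (⇑kG : W → W) = ⇑(blockMap A hind htop g₀ G) := rfl
  have hkk : k = kF' * kG := by
    refine LinearEquiv.ext fun x => ?_
    rw [LinearEquiv.mul_eq_trans, LinearEquiv.trans_apply]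
    have h1 := congrFun hk x
    rw [hunion, blockMap_union hind htop g₀ hgA₀ hdisj, Module.End.mul_apply] at h1
    exact h1
  have hG' := ih _ hcard' F' rfl hbarF' kF' hkF'coe
  have hGfix : tensorSpaceActOver kG s = s := by
    by_cases hii : bar i = i
    · have hGi : G = {i} := by rw [hG, hii, Finset.insert_eq_of_mem (Finset.mem_singleton_self i)]
      refine tensorSpaceActOver_blockMap_singleton_eq_self hind htop hB hBn horth hbar g₀ hg₀orth
        hgA₀ hii (hdet i hii) hs kG ?_
      rw [hkGcoe, hGi]
    · exact tensorSpaceActOver_blockMap_pair_eq_self hind htop hB hBn horth hbar g₀ hg₀orth hgA₀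
        hii hs kG hkGcoe
  rw [hkk, tensorSpaceActOver_mul]
  change tensorSpaceActOver kF' (tensorSpaceActOver kG s) = s
  rw [hGfix, hG']

end Decomposed

end OrthogonalGeneration

end Literature.AlgebraicGeometry.Motives

end
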